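import Mathlib
import HarnessLib
import HarnessLib.Audit
import Summits.Parity.Statement

/-!
Route: QuadraticRoots

CLOSED (retired) 2026-08-15T16:14:30Z by planner-rbadge-Parity-QuadraticRoots-63028613-g2-0 — reason: not-a-thesis: assembly concludes HardyLittlewoodConjE (f = X²+1, BatemanHorn side), not GeneralizedHardyLittlewood; the only glue to _root_.GeneralizedHardyLittlewood is projection of the GHL conjunct carried inside the target QrootsThesis  — note: D-0027 §2.1 route-repair (glue.missing + route.multi-assembly + cone) by planner-rbadge-Parity-QuadraticRoots-63028613-g2-0, 2026-08-15: X3 was a SUMMIT-era thesis 'GHL ∧ [BH-side]' (survey 2026-08-13); after nesting it sits under sub GeneralizedHardyLittlewood, but every non-target item (QrootsWind. The file is kept as the record of this route; refuted decls are indexed as negative knowledge (`ledger negatives`).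

X3 (QuadraticRoots). It suffices to show: GeneralizedHardyLittlewood ∧ [BH-side] for every
Bateman–Horn system f (informative first case f = X²+1, i.e. Hardy–Littlewood E ⊂ BatemanHorn):
writing Λ(f(n)) = ∑_{de = f(n)} μ(d) log e and A_d(x) = #{n ≤ x : d ∣ f(n)} = x ω_f(d)/d + r_d(x),
 (T1) Type-I level x^{1-ε}: ∑_{d ≤ x^{1-ε}} |r_d(x)| ≪ x/(log x)^A (elementary: r_d = O(ω_f(d)));
 (W) parity window, Möbius-twisted root counts: ∃ η > 0 ∀ A: |∑_{D<d≤2D} μ(d) r_d(x)| ≤ x/(log x)^A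
uniformly for x^{1-η} ≤ D ≤ x^{1+η} (for d > x the count A_d(x) is a count of SMALL roots ν ≤ x of
ν² ≡ -1 (mod d): the regime of Duke–Friedlander–Iwaniec / Tóth equidistribution of quadratic roots
and of bilinear Weyl sums for modular square roots [DukeFriedlanderIwaniec1995], [DunnEtAl2019] —
spectral theory of Kloosterman/Salié sums is the imported tool);
 (Q_avg) cofactor Möbius randomness: ∃ η, δ > 0: ∑_{e ≤ x^{1-η}} |∑_{n ≤ x, e ∣ f(n), f(n) > e
x^{1+η}} μ(f(n)/e)| ≪ x/(log x)^{1+δ}.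
Then ∑_{n ≤ x} Λ(f(n)) = H_f x + o(x) (d < x^{1-η}: (T1) gives the main term; d ∈ [x^{1-η},
x^{1+η}]: (W); d > x^{1+η} ⇔ e < x^{1-η}: (Q_avg)), whence BatemanHorn for f by partial summation;
general k via tuple weights.
Lean one-liner (f = X²+1 instance of the BH-side, conjoined with the carried conjunct; elaborates
now):
Literature.NumberTheory.Sieve.GeneralizedHardyLittlewood ∧ ((∃ η : ℝ, 0 < η ∧ ∀ A : ℝ, 0 < A → ∃ x₀
: ℝ, ∀ x D : ℝ, x₀ ≤ x → x ^ (1 - η) ≤ D → D ≤ x ^ (1 + η) → abs (∑ d ∈ Finset.Ioc ⌊D⌋₊ ⌊2 * D⌋₊,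
(ArithmeticFunction.moebius d : ℝ) * (((((Finset.Icc 1 ⌊x⌋₊).filter (fun n : ℕ => d ∣ n ^ 2 +
1)).card : ℕ) : ℝ) - x * (Literature.NumberTheory.Sieve.polyRootCountMod ![(Polynomial.X ^ 2 + 1 :
Polynomial ℤ)] d : ℝ) / d)) ≤ x / Real.log x ^ A)) ∧ (∃ η δ : ℝ, 0 < η ∧ 0 < δ ∧ (fun x : ℝ => ∑ e ∈
Finset.Icc 1 ⌊x ^ (1 - η)⌋₊, |∑ n ∈ (Finset.Icc 1 ⌊x⌋₊).filter (fun n : ℕ => e ∣ n ^ 2 + 1 ∧ (e : ℝ)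
* x ^ (1 + η) < (n : ℝ) ^ 2 + 1), (ArithmeticFunction.moebius ((n ^ 2 + 1) / e) : ℝ)|)
=O[Filter.atTop] fun x : ℝ => x / Real.log x ^ (1 + δ)))

Rationale: WHY THIS LINE. The non-linear conjunct BatemanHorn is where the other routes are weakest:
one-variable value sets are
thin (A(Y) = Y^{1/deg f}), outside Friedlander-Iwaniec's (R1) [FriedlanderIwaniecASP1998] and
outside EH-type
hypotheses. Indexing by the argument n instead (X = x), the sequence n^2+1 has Type-I level
x^{1-eps} elementarily,
so by Bombieri's indeterminacy
(Literature.NumberTheory.Sieve.bombieri_asymptotic_sieve_indeterminacy) ALL of the difficulty is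
parity, and the
identity Lambda = mu*log localises it in two Moebius-twisted objects: (W) mu(d) against counts of
small roots
nu <= x of nu^2 = -1 (mod d), d in [x^{1-eta}, x^{1+eta}], and (Q_avg) mu of the cofactor f(n)/e
along the roots of
f mod e. (W) is a bilinear (Type-II) statement about roots of quadratic congruences -- the objects
whose
equidistribution Duke-Friedlander-Iwaniec proved via the spectral theory of automorphic forms /
Kloosterman-Salie sums
[DukeFriedlanderIwaniec1995] (prime moduli; Toth 2000 all moduli), with power-saving BILINEAR
versions now available
[DunnEtAl2019, Thm 1.7, 1.10]. Area imported: GL_2 spectral theory / sums of Salie sums (PROBLEMS.md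
s3 Parity bullet 3,
"structured polynomial instances -> one-variable f"; cf. Iwaniec 1978 P_2 for n^2+1,
Literature.setOf_isAtMostAlmostPrime...).
For deg f = g >= 3 the window widens to [x^{1-eta}, x^{g/2}] (harder; not decomposed). GHL is
carried as a conjunct.
RANKED CRUXES (f = X^2+1).
 r2 (most informative; the distinctive spectral crux): (W) as in the thesis.
 r3: (Q_avg) as in the thesis (multiplicative flavour; shares its atom with route
MobiusShiftedPrimes r5).
 r4: atom (Q_e): for every e >= 1, sum_{n<=x, e | n^2+1} mu((n^2+1)/e) = o(x)  (e=1: sum mu(n^2+1) =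
o(x)).
 r5 (grounding, PROVABLE): (T1) sum_{d <= x^{1-eps}} |A_d(x) - x omega(d)/d| << x/(log x)^A, omega =
polyRootCountMod.
 rank-1 assembly lemma (PROVABLE given hypotheses): (W) AND (Q_avg) AND
Literature.NumberTheory.Sieve.tendsto_hardyLittlewoodE_partial ->
    Literature.NumberTheory.Sieve.HardyLittlewoodConjE  (bookkeeping above + partial summation from
Lambda-weights to the prime count; the
    constant: -sum_d mu(d) omega(d) log d / d = H = prod_p (1-omega(p)/p)(1-1/p)^{-1} =
hardyLittlewoodEConst, using
    sum_{d<D} mu(d) omega(d)/d << (log D)^{-A} (PNT for Q(i));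
Literature.NumberTheory.Sieve.HardyLittlewoodConjE.isEquivalent for the HL form).
KILL CRITERIA. r2 refuted (e.g. an Omega(x/log x) lower bound for the twisted window sum from a
genuine correlation
of mu(d) with root counts) closes the route; assembly lemma refuted => re-derive the bookkeeping
(pivot); r3 refuted
closes both this route's BH-side and MobiusShiftedPrimes r5.
NOT DECOMPOSED YET. The reduction of (W) to bilinear Salie/Kloosterman sums (Bykovskii/Toth
parametrisation of roots
by ideals of Z[i]); degree >= 3; k >= 2 polynomials; uniformity needed for BatemanHornConjecture
over all systems.

Novelty: NOVELTY (retriage planner, 2026-08-14; searched: lit search --hybrid "roots of quadratic congruences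
equidistribution Möbius moduli n^2+1 Kloosterman" (12 local hits), lit search "largest prime factor
of n^2+1 Type II bilinear quadratic roots" (12 local + zbMATH/Crossref 22; OpenAlex/S2/arXiv
rate-limited), lit frontier Parity --since 2020 (30 rows), lit bridges Parity --cross any (30 rows),
lean search on every cited decl, barrier catalogue Literature/Barriers/Parity (24 decls; 7 read);
page reads this pass: Merikoski2022 = arXiv:1908.08816 pp.2–5, Grimmelt–Merikoski arXiv:2505.00493
pp.2–4, Pascadi arXiv:2404.04239 p.2; relied on the grounders' page-verified reads of DunnEtAl2019 =
arXiv:1908.10143 pp.4–6, Teravainen2024 = arXiv:2010.07924 pp.3–4, Hooley1976 pp.25–28,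
MontgomeryVaughan2007 pp.145,147,294, Ribenboim1989 p.236).
Nearest prior art. (1) The n-indexed Chebyshev–Hooley set-up Σ_{n~x} Σ_{m | n²+1} Λ(m) = 2x log x +
O(x), fed by Type-I/Type-II information on A_d(x) = #{n ~ x : d | n²+1} for moduli d BEYOND x, is
exactly the machine of the greatest-prime-factor literature: Hooley 1967 (doi:10.1007/BF02395047; P⁺
> x^{1.1}, Weil bound), Deshouillers–Iwaniec 1982 (x^{1.202}; sums of Kloosterman sums), de la
Bretèche–Drappeau JEMS 2020 (x^{1.2182}; Type-I level for d | m ~ x^α = Merikoski2022 p.5 Prop. 3),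
Merikoski2022 (x^{1.279}; first Type-II information, p.5 Prop. 4: mn = x^α, x^{α−1+η} ≪ n ≪
x^{(57−32α)/96−η}, Harman's sieve), Pascadi arXiv:2404.04239 (x^{1.3}; la  [refs: 10.1007/BF02395047, 10.2307/2118527, 1908.08816, 2505.00493, 2404.04239, 1908.10143, 2010.07924, 1809.05211, doi:10.1007/BF02395047, doi:10.2307/2118527, Merikoski2022, DunnEtAl2019, Teravainen2024, Hooley1976, MontgomeryVaughan2007, Ribenboim1989, DukeFriedlanderIwaniec1995, Toth2000, Ford2004, BombieriAsymptoticSieve1976, FriedlanderIwaniecASP1998, IwaniecInventiones1978]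

Barriers (technique_class: asymptotic-sieve type-I type-II quadratic-roots spectral): BARRIERS (catalogue Literature/Barriers/Parity: 24 decls scanned by technique_class with the gate
tokenizer; read at the structured block: SelbergParity, FordFixedLevel, FordMaynardPrimeSieves (both
decls), LinearSieveOptimality, UniformBatemanHorn, SiegelZeroQuadraticPolynomials; skimmed
EquidistributionLimits, FunctionFieldMobiusBias).
technique_class: asymptotic-sieve type-I type-II quadratic-roots spectral
- Literature.Barriers.Parity.SelbergParityBarrier [sieve type-I level-of-distribution
combinatorial-sieve selberg-sieve linear-sieve]: APPLIES to the frame — item (T1) is pure Type-I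
data of level x^{1−ε}, from which no positive lower bound for the prime mass of n ↦ 1 (weights
Λ(n²+1)), let alone HL-E, can follow (tree:
Literature.NumberTheory.Sieve.no_typeI_prime_lower_bound,
Literature.NumberTheory.Sieve.bombieri_asymptotic_sieve_indeterminacy, both cited in the rationale).
Evasion is the route's design: all parity-sensitive content is isolated in the non-Type-I items (W)
(μ(d)-twisted remainders across d ∈ [x^{1−η}, x^{1+η}]) and (Q_avg)/(Q_e) (μ of the cofactor along
root classes). Caveat from this pass: as typed (Q_avg) is vacuous, so the filed Assembly leans on
(W) alone for all d > x^{1−η}; by this barrier plus the d ↔ (n²+1)/d symmetry it cannot — the tenure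
planner must retype (shared η < 1).
- Literature.Barriers.Parity.FordFixedLevelBarrier [sieve type-I level-of-distribution
bombieri-vinogradov asymptotic-sieve almost-primes]: APPLIES to any attempt to read

History (route lifecycle, newest last):
- 2026-08-15T16:14:31Z · CLOSED retired — not-a-thesis: assembly concludes HardyLittlewoodConjE (f = X²+1, BatemanHorn side), not GeneralizedHardyLittlewood; the only glue to _root_.GeneralizedHardyLittlewood is projection of the GHL conjunct (planner-rbadge-Parity-QuadraticRoots-63028613-g2-0)

sub-problem: GeneralizedHardyLittlewood · status: closed(retired) · opened planner-Parity-Survey-0 2026-08-13T13:22:21Z · rev 1 · ledger route-Parity-QuadraticRoots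
GENERATED by the gate from the ledger (D-0016/17). Provers cite these decls: `theorem foo : Summit.Parity.GeneralizedHardyLittlewood.Theses.QuadraticRoots.<Decl> := …` in Summits/Parity/GeneralizedHardyLittlewood/Theorems/<Name>.lean.
-/

namespace Summit.Parity.GeneralizedHardyLittlewood.Theses.QuadraticRoots

open scoped BigOperators Topology Manifold Classical MeasureTheory ProbabilityTheory Matrix InnerProductSpace ComplexConjugate ContinuousMap
open Filter Set Function TopologicalSpace MeasureTheory

attribute [summit_statement] _root_.GeneralizedHardyLittlewood

/-- item stmt-Parity-0646 · target · rank 0 · closed · moot by None · by planner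
why it might fail: As typed conjunct (Q_avg)=0649 is vacuous (η unbounded above: η=2 empties the e-range; Lean rc0), so X ≡ GHL ∧ (W); X→HL-E then has the d > x^{1+η} divisors uncovered, and X reaches HL-E only, not the summit. GHL (all complexities) and (W) are each wide open; either failing sinks X.
sources: refuter notes g2-0/g2-1/g2-5/g2-7 on stmt-Parity-0647 (independent-η coverage gap; sub-dyadic (W); PNT(ℚ(i)) fact hypotheses missing), planner scratch Vacuity0649.lean (lean check rc0, 2026-08-14): QrootsCofactorAvg holds with η = 2, δ = 1 (empty e-sum), GrimmeltMerikoski arXiv:2505.00493 p.3 Thm 1.5 (Type II for ℓ²+h ≡ 0 (mn) nontrivial only for n < X^{1/3} at mn ~ X), DunnEtAl2019 = arXiv:1908.10143 p.5 Thm 1.7, p.6 Thm 1.10 (bilinear Weyl sums of modular square roots, fixed prime modulus), GreenTao2010 Conj. 1.2 = Literature.NumberTheory.Sieve.GeneralizedHardyLittlewood (open beyond finite complexity; carried conjunct)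
X3: GeneralizedHardyLittlewood ∧ [for every BH system f: (T1) Type-I level x^{1-ε} for A_d(x)=#{n≤x:
d|f(n)} (elementary) ∧ (W) Möbius-twisted remainder cancellation across the parity window D ∈
[x^{1-η}, x^{deg/2+η}] ∧ (Q_avg) Möbius randomness of cofactors f(n)/e along roots of f mod e, e ≤
x^{1-η}]. Signature = GHL ∧ (W) ∧ (Q_avg) for f = X²+1 (Hardy–Littlewood E instance). -/
@[route_item "route-Parity-QuadraticRoots"]
def QrootsThesis : Prop :=
  Literature.NumberTheory.Sieve.GeneralizedHardyLittlewood ∧ ((∃ η : ℝ, 0 < η ∧ ∀ A : ℝ, 0 < A → ∃ x₀ : ℝ, ∀ x D : ℝ, x₀ ≤ x → x ^ (1 - η) ≤ D → D ≤ x ^ (1 + η) → abs (∑ d ∈ Finset.Ioc ⌊D⌋₊ ⌊2 * D⌋₊, (ArithmeticFunction.moebius d : ℝ) * (((((Finset.Icc 1 ⌊x⌋₊).filter (fun n : ℕ => d ∣ n ^ 2 + 1)).card : ℕ) : ℝ) - x * (Literature.NumberTheory.Sieve.polyRootCountMod ![(Polynomial.X ^ 2 + 1 : Polynomial ℤ)]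 d : ℝ) / d)) ≤ x / Real.log x ^ A)) ∧ (∃ η δ : ℝ, 0 < η ∧ 0 < δ ∧ (fun x : ℝ => ∑ e ∈ Finset.Icc 1 ⌊x ^ (1 - η)⌋₊, |∑ n ∈ (Finset.Icc 1 ⌊x⌋₊).filter (fun n : ℕ => e ∣ n ^ 2 + 1 ∧ (e : ℝ) * x ^ (1 + η) < (n : ℝ) ^ 2 + 1), (ArithmeticFunction.moebius ((n ^ 2 + 1) / e) : ℝ)|) =O[Filter.atTop] fun x : ℝ => x / Real.log x ^ (1 + δ))

/-- item stmt-Parity-0648 · crux · rank 2 · closed · moot by None · by planner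
why it might fail: μ(d) over moduli d~x^{1±η} needs (Heath-Brown identity) Type-II asymptotics for A_{mn}(x), mn~x, for ALL n∈[x^ϑ,x^{1/2}]; print stops at n<x^{1/3} (arXiv:2505.00493 Thm 1.5; Merikoski2022 Prop 4): the balanced range is the spectral method's diagonal. Top of window = μ of cofactors (Chowla-type).
sources: Merikoski2022 = arXiv:1908.08816 p.5 Prop. 4 (Type II for |A_{mn}|, MN = x^α: x^{α−1+η} ≪ N ≪ x^{(57−32α)/96−η}) and p.4 ('even for P = x^{1+ε} … the linear sieve upper bound is off by a factor of 4'), GrimmeltMerikoski arXiv:2505.00493 p.3 Thm 1.4 (Type I, D ≤ X^{1/2}) and Thm 1.5 (Type II: M^{1/2}X^{1/2} + M^{1/4}N X^{1/2}(…)^θ, nontrivial for N < X^{1/3} at MN ~ X), DukeFriedlanderIwaniec1995 (doi:10.2307/2118527): ν/p equidistributed, prime moduli, no μ-twist (paywalled, acq-00058); Toth2000: all moduli, DunnEtAl2019 = arXiv:1908.10143 p.5 Thm 1.7, p.6 Thm 1.10 (fixed prime modulus q; not a sum over moduli), Hooley1976 pp.27–28 eqs (50),(53)–(56): N_x(l)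 for l > x through ρ(h,l) = Σ_{ν² ≡ −1 (l)} e(hν/l) (the 'small roots' reading), Literature.Barriers.Parity.FordMaynardMinimalTypeII / FordMaynardLowLevel (Literature/Barriers/Parity/FordMaynardPrimeSieves.lean): minimal Type-II width; thin-set dictionary θ > 1/2 in the value scale X = x²
(W) for f = X²+1: there is η > 0 such that for every A > 0, all large x and all D with x^{1-η} ≤ D ≤
x^{1+η}: |∑_{D<d≤2D} μ(d) (#{n ≤ x : d ∣ n²+1} - x ω(d)/d)| ≤ x/(log x)^A, ω(d) = polyRootCountMod
(X²+1) d. For d > x this is Möbius against counts of small roots ν ≤ x of ν² ≡ -1 (mod d)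
(DFI/Tóth/DKSZ regime). Trivial bound ≍ D·(mean ω) ≫ x. Open; the distinctive spectral crux. -/
@[route_item "route-Parity-QuadraticRoots"]
def QrootsWindowW : Prop :=
  ∃ η : ℝ, 0 < η ∧ ∀ A : ℝ, 0 < A → ∃ x₀ : ℝ, ∀ x D : ℝ, x₀ ≤ x → x ^ (1 - η) ≤ D → D ≤ x ^ (1 + η) → abs (∑ d ∈ Finset.Ioc ⌊D⌋₊ ⌊2 * D⌋₊, (ArithmeticFunction.moebius d : ℝ) * (((((Finset.Icc 1 ⌊x⌋₊).filter (fun n : ℕ => d ∣ n ^ 2 + 1)).card : ℕ) : ℝ) - x * (Literature.NumberTheory.Sieve.polyRootCountMod ![(Polynomial.X ^ 2 + 1 : Polynomial ℤ)] d : ℝ) / d)) ≤ x / Real.log x ^ A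

/-- item stmt-Parity-0650 · crux · rank 4 · closed · moot by None · by planner
why it might fail: μ-form of Chowla's polynomial conjecture for the quadratics e·m²+2νm+(ν²+1)/e (e=1: Σμ(n²+1)=o(x)): wide open for every nonlinear irreducible polynomial; only sign changes of λ(n²+1) known; MR/MRT/entropy methods miss sparse orbits; a positive-density μ-bias on one root class refutes it and (Q_avg).
sources: Teravainen2024 = arXiv:2010.07924 p.3 Conj. 1.2 + eq. (1.1) ('wide open for any polynomials with nonlinear irreducible factors'); p.4 Thm 2.3 (sign changes only), arXiv:2408.08726 p.3 eq. (1.1) (polynomial Chowla 'remains an open problem'); arXiv:2104.15004 pp.1–2 (sign changes of λ(x²+d) only), Literature.setOf_isAtMostAlmostPrime_two_sq_add_one_infinite (IwaniecInventiones1978, P₂: strongest unconditional result for n²+1); Harman2007 p.286 (n²+1: no Type II information), stmt-Parity-0615 (e = 1 twin on route MobiusShiftedPrimes; refuter g3-1 numerics Σ_{n<N} μ(n²+1)/N = 0.017, 0.013, 0.0035, −0.0004 at N = 5k…30k, no bias), grounder reground note on this item (symbol comparison μ((n²+1)/e) vs λ(P(n)); P_{ν,e}(m) = e m² + 2νm +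 (ν²+1)/e)
Atom (Q_e): for every e ≥ 1, ∑_{n ≤ x, e ∣ n²+1} μ((n²+1)/e) = o(x). (e = 1 is Möbius randomness
along n²+1, cf. stmt-Parity-0615; general e is its version along the arithmetic progressions of
roots of n²+1 mod e.) Open. -/
@[route_item "route-Parity-QuadraticRoots"]
def QrootsCofactorPointwise : Prop :=
  ∀ e : ℕ, 1 ≤ e → (fun x : ℕ => ∑ n ∈ (Finset.Icc 1 x).filter (fun n : ℕ => e ∣ n ^ 2 + 1), (ArithmeticFunction.moebius ((n ^ 2 + 1) / e) : ℝ)) =o[Filter.atTop] fun x : ℕ => (x : ℝ)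

/-- item stmt-Parity-0649 · support · rank 3 · closed · moot by None · by planner
sources: planner scratch Vacuity0649.lean (lean check rc0): `example : QrootsCofactorAvg := ⟨2, 1, …⟩`, 11 lines, Nat.floor_eq_zero + Finset.Icc_eq_empty_of_lt, Teravainen2024 = arXiv:2010.07924 p.3 Conj. 1.2 / eq. (1.1) (the intended content, μ-form of polynomial Chowla along root classes, is open), refuter notes g2-5/g2-7/g2-0 on this item (non-monotone in η; shared-η retyping) and g2-1/g2-5/g2-7 on stmt-Parity-0647 (FIX signatures)
(Q_avg) for f = X²+1: ∃ η, δ > 0: ∑_{e ≤ x^{1-η}} |∑_{n ≤ x, e ∣ n²+1, n²+1 > e·x^{1+η}}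
μ((n²+1)/e)| ≪ x/(log x)^{1+δ} (Möbius randomness of the large cofactor along the roots of n²+1 mod
e, on average over e with (log x)^{2+δ} saving over the trivial bound ≍ x log x). Open
(parity-type). -/
@[route_item "route-Parity-QuadraticRoots"]
def QrootsCofactorAvg : Prop :=
  ∃ η δ : ℝ, 0 < η ∧ 0 < δ ∧ (fun x : ℝ => ∑ e ∈ Finset.Icc 1 ⌊x ^ (1 - η)⌋₊, |∑ n ∈ (Finset.Icc 1 ⌊x⌋₊).filter (fun n : ℕ => e ∣ n ^ 2 + 1 ∧ (e : ℝ) * x ^ (1 + η) < (n : ℝ) ^ 2 + 1), (ArithmeticFunction.moebius ((n ^ 2 + 1) / e) : ℝ)|) =O[Filter.atTop] fun x : ℝ => x / Real.log x ^ (1 + δ)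

/-- item stmt-Parity-1338 · support · rank 3 · closed · moot by None · by planner
[crux] (Q⁺) for f = X²+1, COFACTOR Möbius randomness, uniform in η and in the height (route-repair
2026-08-15; replaces the VACUOUS (Q_avg) = stmt-Parity-0649, η = 2): ∀ η > 0 ∃ δ > 0, for all large
x and all 1 ≤ t ≤ x: ∑_{e ≥ 1} |∑_{n ≤ t, e ∣ n²+1, e·x^{1+η} < n²+1} μ((n²+1)/e)| ≤ x/(log x)^{1+δ}
(only e < x^{1−η} + x^{−1−η} have a non-empty inner sum; e·x^{1+η} < n²+1 ⇔ the divisor (n²+1)/e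
exceeds x^{1+η}). WHY IT MIGHT FAIL: μ-form of polynomial Chowla along root classes (cofactor = e m²
+ 2νm + (ν²+1)/e); at e ≍ x^{1−η} the inner sums have ≍ x^η terms per root ν mod e (short sparse
quadratic orbits); needs a (log x)^{2+δ} average saving over e (trivial ≍ (1−η) x log x at t = x:
non-vacuous for every η ∈ (0,1), trivially true for η ≥ 1); thin-set half of Ford–Maynard (c = 1/2):
no Type-I/II mechanism; open even for e = 1 as o(x). SOURCES: Teravainen2024 = arXiv:2010.07924 p.3
Conj. 1.2, Thm 2.3; SawinShusterman2022 = arXiv:2008.09905 Thm 1.3, §1.2 p.4; decls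
Literature.Barriers.Parity.FordMaynardLowLevel, .SelbergParityBarrier; IwaniecInventiones1978 (P₂);
stmt-Parity-0650 (pointwise atom), stmt-Parity-0615 (e = 1, refuter g3-1 numerics: no bias);
refuters g2-0/5/7 on stmt-Par -/
@[route_item "route-Parity-QuadraticRoots"]
def QrootsCofactorUniform : Prop :=
  ∀ η : ℝ, 0 < η → ∃ δ : ℝ, 0 < δ ∧ ∃ x₀ : ℝ, ∀ x t : ℝ, x₀ ≤ x → 1 ≤ t → t ≤ x → ∑ e ∈ Finset.Icc 1 ⌊x⌋₊, |∑ n ∈ (Finset.Icc 1 ⌊t⌋₊).filter (fun n : ℕ => e ∣ n ^ 2 + 1 ∧ (e : ℝ) * x ^ (1 + η) < (n : ℝ) ^ 2 + 1), (ArithmeticFunction.moebius ((n ^ 2 + 1) / e) : ℝ)| ≤ x / Real.log x ^ (1 + δ)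

/-- item stmt-Parity-0651 · support · rank 5 · closed · moot by None · by planner
sources: Hooley1976 pp.25, 56 (Type-I for n²+1: |A_d(x) − xρ(d)/d| ≤ ρ(d); Σ_{d≤y} ρ(d) ≪ y log y) — reground-corrected locator, HalberstamRichert1974 Ch. 1 (|R_d| ≤ ρ(d) for polynomial sequences), Literature.NumberTheory.Sieve.polyRootCountMod_le (Literature/NumberTheory/Sieve/BatemanHorn.lean:150); refuters g2-0/g2-3/g2-5/g2-7 Lean plans (150–400 lines)
(T1), grounding and PROVABLE: for every ε, A > 0, ∑_{d ≤ x^{1-ε}} |#{n ≤ x : d ∣ n²+1} - x ω(d)/d| ≪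
x/(log x)^A, since each remainder is O(ω(d)) (complete residue systems) and ∑_{d ≤ D} ω(d) ≪ D log D
with D = x^{1-ε}. -/
@[route_item "route-Parity-QuadraticRoots"]
def QrootsTypeIT1 : Prop :=
  ∀ ε A : ℝ, 0 < ε → 0 < A → (fun x : ℝ => ∑ d ∈ Finset.Icc 1 ⌊x ^ (1 - ε)⌋₊, |((((Finset.Icc 1 ⌊x⌋₊).filter (fun n : ℕ => d ∣ n ^ 2 + 1)).card : ℕ) : ℝ) - x * (Literature.NumberTheory.Sieve.polyRootCountMod ![(Polynomial.X ^ 2 + 1 : Polynomial ℤ)] d : ℝ) / d|) =O[Filter.atTop] fun x : ℝ => x / Real.log x ^ A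

/-- item stmt-Parity-0647 · assembly · rank 1 · closed · moot by None · by planner
Assembly, first (provable) piece: (W) ∧ (Q_avg) ∧ tendsto_hardyLittlewoodE_partial →
HardyLittlewoodConjE (#{n ≤ x : n²+1 prime} ~ (𝔖/2) x/log x). Bookkeeping: Λ(n²+1) = ∑_{de=n²+1}
μ(d) log e; d < x^{1-η}: Type-I (T1, elementary, r_d = O(ω(d))) with main term H x, H = -∑_d
μ(d)ω(d) log d/d = ∏_p (1-ω(p)/p)(1-1/p)^{-1} = hardyLittlewoodEConst (needs ∑_{d<D} μ(d)ω(d)/d ≪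
(log D)^{-A}, PNT for ℚ(i)); window d ∈ [x^{1-η},x^{1+η}]: (W) with log weights by partial summation
over dyadic D; d > x^{1+η} ⇔ e < x^{1-η}: (Q_avg); then pass from Λ-weights to the count (prime
powers negligible) and use Literature.NumberTheory.Sieve.HardyLittlewoodConjE.isEquivalent. Full
assembly X3 → Parity: same for general f (window [x^{1-η}, x^{g/2+η}]) and k ≥ 2 via tuple weights
(informal), conjoined with GHL. -/
@[route_item "route-Parity-QuadraticRoots"]
def Assembly : Prop :=
  (∃ η : ℝ, 0 < η ∧ ∀ A : ℝ, 0 < A → ∃ x₀ : ℝ, ∀ x D : ℝ, x₀ ≤ x → x ^ (1 - η) ≤ D → D ≤ x ^ (1 + η) → abs (∑ d ∈ Finset.Ioc ⌊D⌋₊ ⌊2 * D⌋₊, (ArithmeticFunction.moebius d : ℝ) * (((((Finset.Icc 1 ⌊x⌋₊).filter (fun n : ℕ => d ∣ n ^ 2 + 1)).card : ℕ) : ℝ) - x * (Literature.NumberTheory.Sieve.polyRootCountMod ![(Polynomial.X ^ 2 + 1 : Polynomial ℤ)] d : ℝ) / d)) ≤ x / Real.log x ^ A) → (∃ η δ : ℝ,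 0 < η ∧ 0 < δ ∧ (fun x : ℝ => ∑ e ∈ Finset.Icc 1 ⌊x ^ (1 - η)⌋₊, |∑ n ∈ (Finset.Icc 1 ⌊x⌋₊).filter (fun n : ℕ => e ∣ n ^ 2 + 1 ∧ (e : ℝ) * x ^ (1 + η) < (n : ℝ) ^ 2 + 1), (ArithmeticFunction.moebius ((n ^ 2 + 1) / e) : ℝ)|) =O[Filter.atTop] fun x : ℝ => x / Real.log x ^ (1 + δ)) → Literature.NumberTheory.Sieve.tendsto_hardyLittlewoodE_partial → Literature.NumberTheory.Sieve.HardyLittlewoodConjE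

/-- item stmt-Parity-1339 · assembly · rank 9 · closed · moot by None · by planner
[support] (P2), the PNT(ℚ(i))-strength main-term input of the Assembly, PROVABLE NOW (route-repair
2026-08-15): ∑_{d ≤ N} μ(d)ω(d) log d/d → −H, ω = polyRootCountMod (X²+1) (ω(2) = 1, ω(p) = 1 +
χ₋₄(p), multiplicative on squarefree d), H = hardyLittlewoodEConst = lim
∏_{p≤x}(1−1/p)^{−1}(1−ω(p)/p) (proved: hasBatemanHornConst_hardyLittlewoodEConst). PROOF ROUTE: ω(d)
= ∑_{k | d, k odd} χ₋₄(k) on squarefree d; hyperbola split; the PROVED facts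
Literature.NumberTheory.LFunctions.SiegelWalfiszMoebius_holds (MontgomeryVaughan2007 §11.3 Ex.
13(f)) and SiegelWalfiszMoebius.sum_coprime_progression_le give ∑_{d≤y} μ(d)ω(d) ≪_A y(log y)^{−A};
Abel summation ⇒ ∑ μω/d → 0 with rate (lemma P1, file with --supports) and F(N) = ∑_{d≤N} μω log d/d
converges; VALUE: for real s > 1, G(s) = ∑ μω d^{−s} = ∏_p (1 − ω(p)p^{−s}), ζ(s)G(s) → H (s → 1⁺;
Abelian comparison with the ordered product), and ζ(s)G(s) = ((s−1)ζ(s))·(G(s) − G(1))/(s−1) →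
G'(1⁺) = −lim F (Mathlib riemannZeta residue at 1). k = 1 analogue: ∑ μ(n) log n/n = −1. NUMERICS
(planner 2026-08-15): F(3·10⁵) = −1.3730, F(10⁶) = −1.3690, F(3·10⁶) = −1.3710 vs −H = −1.37281
(Ribenboim1989 p.236). SOURCES: MontgomeryVaughan2007 §11.3 Ex. 8, 13( -/
@[route_item "route-Parity-QuadraticRoots"]
def Assembly2 : Prop :=
  Filter.Tendsto (fun N : ℕ => ∑ d ∈ Finset.Icc 1 N, (ArithmeticFunction.moebius d : ℝ) * (Literature.NumberTheory.Sieve.polyRootCountMod ![(Polynomial.X ^ 2 + 1 : Polynomial ℤ)] d : ℝ) * Real.log d / d) Filter.atTop (nhds (-Literature.NumberTheory.Sieve.hardyLittlewoodEConst))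

end Summit.Parity.GeneralizedHardyLittlewood.Theses.QuadraticRoots
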